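import Literature.MathematicalPhysics.QuantumFieldTheory.Balaban1983to89.B9Thm31CubeLocalFlat
import Literature.MathematicalPhysics.QuantumFieldTheory.Balaban1983to89.B9Ineq346SecondOrderTorusCore

/-!
# `Balaban1983to89.B9Thm31CubeLocalFlatTransposed` — [B9] THEOREM 3.1 (3.42) AT `U = 1` FOR THE CUBE-LOCAL `G′_□`: THE TWO
# TRANSPOSED ORIENTATIONS `∇*_μG′_□` (backward difference on the LEFT) and `G′_□∇_μ` (forward difference on the RIGHT), in
# block-majorant form, from the printed orientations `∇_μG′_□`, `G′_□∇*_μ` of file 2 (`B9Thm31CubeLocalFlat` §6) by ONE unit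
# torus translation — sub-row G-B9-LETTERS, module M5.1a, file 2b (Sect. B's engine `B9Thm34SectBUniformR1.thm34_Gp_uniform`
# reads (3.42) for `G′_□(1)` in all four orientations; p33's located ask 2026-08-28)

FRAMING (verbatim cell line):
statement-level skeleton of published theorems with citation tags; proofs where landed; nothing here is a claim about the Yang–Mills mass gap

Sources under audit (cell lit-balaban): T. Bałaban, *Propagators for lattice gauge theories in a background field*, Commun.
Math. Phys. **99** (1985) 389–434 [`Balaban1985BackgroundPropagators`, "B9"], Thm 3.1 (3.42) p. 397, Cor. 3.5 p. 407, Sect. C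
p. 409 l. 1–5; T. Bałaban, *Propagators and renormalization transformations for lattice gauge theories. II*, Commun. Math.
Phys. **96** (1984) 223–250 [`Balaban1984PropagatorsII`, "[4]"], Prop. 2.2 (2.67) p. 234, (2.51)–(2.55) p. 232 («this property
is preserved under the composition of operators possessing it»), (2.46) p. 231 (admissible bonds), (2.58) p. 233 (packing).
Unit `lit-balaban-r05` (r05 gen 85; G-B9-LETTERS M5.1a, map `lit-balaban-r06/B9-LETTERS-MAP.md` §4); B9 fold owner r06,
B6 fold owner r03, referee ref-4.

## WHAT IS PRINTED (verbatim up to notation)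

[B9] Thm 3.1 (3.42) p. 397: «|(G′(U)λ)(x)|, |(∇_UG′(U)λ)(x)|, |(G′(U)∇*_Uλ)(x)|, |(Δ_UG′(U)λ)(x)| ≦ B₀[(L^jη)², L^jη, L^jη,
1]e^{−δ₀d(y,y′)}|λ| for x ∈ Δ(y), y ∈ Λ_j, supp λ ⊂ Δ(y′)»; p. 409 l. 1–5: the cube-local operators `G′_□(U)` «satisfy all the
inequalities of Theorems 3.1–3.3»; p. 407: at `U = 1` these are [4] Prop. 2.2 (2.67).  Print states the first-order entries
for the forward covariant derivative on the left and its adjoint on the right.  On the unit lattice `∇*_μ = −σ_{−e_μ}∇_μ`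
and `G′∇_μ = −(G′∇*_μ)σ_{e_μ}` (`σ_v f = f(· + v)`), and [4] p. 232: «this property [a block majorant] is preserved under
the composition of operators possessing it» — a unit translation has the block majorant «`1` on touching blocks», so the two
remaining orientations `∇*_μG′`, `G′∇_μ` obey (3.42)₂,₃ with the same rate and `O(1)`-changed constants.  This file
certifies exactly that transport, at `U = 1`, for the cube letters of file 2.

## WHAT THIS FILE CERTIFIES (kernel-checked; lattice units `η = 1`)

* §1 **SHIFT ALGEBRA ON THE TORUS BOX** `boxDom N` (BY NAME from `B9Ineq346SecondOrderTorusCore`: `shiftMat_mul`,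
  `shiftMat_zero`, `dT_transpose`): `S_{−v}S_v = 1`, hence **`(dT N μ)ᵀ * X = −(shiftMat N (−e_μ) * (dT N μ * X))`**
  (`dT_transpose_mul`) and **`X * dT N μ = −((X * (dT N μ)ᵀ) * shiftMat N e_μ)`** (`mul_dT`); a translation by `|v|_∞ ≤ 1`
  moves every site by at most one on the torus (`torusSupNorm_tshift_sub_le`).
* §2 **UNIT STEPS AND BLOCKS** of a level-0 torus family `D : B6MultiLevelTorusOperatorL0.TDomains` (geometry `geomT D`,
  blocks `blkOf`): two sites at torus sup-distance `≤ 1` lie in equal or adjacent blocks (`(bondT D).dist ≤ 1`), whose levels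
  differ by at most one (`separates_of_levelGap levelGapT`); **THE BLOCKS TOUCHING A GIVEN BLOCK NUMBER AT MOST
  `3(2L+1)^{d+1}`** (`card_touching_le`: per level `j−1, j, j+1` by the packing `packT` and the bond lengths
  `dist_posT_le_of_touchT`).
* §3 **BLOCK MAJORANTS UNDER A UNIT TRANSLATION** (any matrix `Y` on the torus box, any `v` with `|v|_∞ ≤ 1`):
  LEFT `hasMajorant_shiftMat_mul` (`σ_vY`: the majorant read at the touching block of the row — pointwise, no count) and
  RIGHT `hasMajorant_mul_shiftMat` (`Yσ_v`: the block decomposition (2.52) of the translated source, at most `3(2L+1)^{d+1}`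
  touching pieces); the (2.67)-shaped corollaries `hasMajorant_shiftMat_mul_levelExp` (`C·L^{j(y)}e^{−δd}` ↦
  `C·L·e^{δ}·L^{j(y)}e^{−δd}`) and `hasMajorant_mul_shiftMat_rowExp` (`F(y)e^{−δd}` ↦ `3(2L+1)^{d+1}e^{δ}·F(y)e^{−δd}`).
* §4 **THE TWO TRANSPORTS** for any `X`: `hasMajorant_dT_transpose_mul` (from a (2.67)₂-majorant of `∂_μX` to one of
  `∂_μᵀX = ∇*_μX`) and `hasMajorant_mul_dT` (from a (2.67)₃-majorant of `X∂_μᵀ` to one of `X∂_μ`), same rate `δ`.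
* §5 **AT THE CUBE LETTERS OF FILE 2** (binders VERBATIM those of `B9Thm31CubeLocalFlat.thm31_cubeW_flat_second ∕ _third`,
  constants `∃ δ₀ C M₀ N₀` functions of `d, L` only, rate `δ₀/2` UNCHANGED):
  ★ `thm31_cubeW_flat_second_transpose` — `(dT μ)ᵀ * GpCubeW` (= `∇*_μG′_□(1)`) has the block majorant
  `C·L^{j(y)}·e^{−(δ₀/2)d(y,y′)}`; ★ `thm31_cubeW_flat_third_transpose` — `GpCubeW * dT μ` (= `G′_□(1)∇_μ`) likewise.

## HONEST SCOPE

* `U = 1`, the cube family and weights `wCube` of file 2 (its HONEST SCOPE applies verbatim); lattice units.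
* Print's (3.42) lists `∇_UG′` and `G′∇*_U`; the two orientations certified here are NOT separately displayed in print — they
  are the printed ones composed with a unit translation ([4] p. 232 composition remark), which at `U = 1` is the elementary
  identity `∇* = −σ_{−e}∇`.  For general `U` the analogous transport needs the parallel transporter of the bond (not here).
* The touching-block count `3(2L+1)^{d+1}` is a convenient bound, not print's; it enters only the existential constant `C`.
* Nothing is inferred from the manuscript: every step is kernel-checked.  NOT summit progress; the YM mass gap is not
  proved by any of this (Track A conditional rung).
-/

namespace Literature.MathematicalPhysics.QuantumFieldTheory.Balaban1983to89.B9Thm31CubeLocalFlatTransposed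

open Finset Matrix
open Literature.MathematicalPhysics.QuantumFieldTheory.Balaban1983to89.B4ContourShift (supNorm abs_le_supNorm)
open Literature.MathematicalPhysics.QuantumFieldTheory.Balaban1983to89.B4Reflection242 (boxDom)
open Literature.MathematicalPhysics.QuantumFieldTheory.Balaban1983to89.B4TorusKernel.MultiPeriod (torusSupNorm
  torusSupNorm_translate torusSupNorm_le_supNorm translate)
open Literature.MathematicalPhysics.QuantumFieldTheory.Balaban1983to89.B6Geom246MultiLevelTorus (torusSupNorm_neg TPt)
open Literature.MathematicalPhysics.QuantumFieldTheory.Balaban1983to89.B6MultiLevelBoxOperator (N0)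
open Literature.MathematicalPhysics.QuantumFieldTheory.Balaban1983to89.B6MultiLevelTorusOperator (tshift shiftMat unitVec
  one_le_of_mem shiftMat_mulVec tshift_val_eq_translate)
open Literature.MathematicalPhysics.QuantumFieldTheory.Balaban1983to89.B6Prop22DerivMultiLevelTorus (dT)
open Literature.MathematicalPhysics.QuantumFieldTheory.Balaban1983to89.B6RandomWalk (HasMajorant BlockSupp blockPiece
  sum_blockPiece blockSupp_blockPiece hasMajorant_mono)
open Literature.MathematicalPhysics.QuantumFieldTheory.Balaban1983to89.B6Geometry (separates_of_levelGap)
open Literature.MathematicalPhysics.QuantumFieldTheory.Balaban1983to89.B6Geom246MultiLevelBoxL0 (blkOf bset)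
open Literature.MathematicalPhysics.QuantumFieldTheory.Balaban1983to89.B6Geom246MultiLevelTorusL0 (geomT TouchT bondT
  bondT_adj levelGapT packT posT dist_posT_le_of_touchT connectedT)
open Literature.MathematicalPhysics.QuantumFieldTheory.Balaban1983to89.B6Cover236MultiLevelBlocks (cubes)
open Literature.MathematicalPhysics.QuantumFieldTheory.Balaban1983to89.B9CubeSequence408 (cubeFam)
open Literature.MathematicalPhysics.QuantumFieldTheory.Balaban1983to89.B9Thm31CubeLocalFlat (GpCubeW
  thm31_cubeW_flat_second thm31_cubeW_flat_third)
open Literature.MathematicalPhysics.QuantumFieldTheory.Balaban1983to89.B9Ineq346SecondOrderTorusCore (shiftMat_mul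
  shiftMat_zero dT_transpose)

noncomputable section

variable {d : ℕ}

/-! ## §1 Shift algebra on the torus box -/

section ShiftAlgebra

variable (N : Fin (d + 1) → ℕ)

/-- `S_{−v} S_v = 1`. [cite: Balaban1983RegularityDecay, p.572 («a torus T_η … with periodic conditions»), dictionary] -/
theorem shiftMat_neg_mul_shiftMat (v : Fin (d + 1) → ℤ) : shiftMat N (-v) * shiftMat N v = 1 := by
  rw [shiftMat_mul, neg_add_cancel, shiftMat_zero]

/-- `S_v S_{−v} = 1`. [cite: Balaban1983RegularityDecay, p.572 («a torus T_η … with periodic conditions»), dictionary] -/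
theorem shiftMat_mul_shiftMat_neg (v : Fin (d + 1) → ℤ) : shiftMat N v * shiftMat N (-v) = 1 := by
  rw [shiftMat_mul, add_neg_cancel, shiftMat_zero]

/-- **`∂_μᵀX = −σ_{−e_μ}(∂_μX)`**: the backward-difference-on-the-left of an operator is a unit translate of its
forward-difference-on-the-left. [cite: Balaban1984PropagatorsII, (2.67) p.234 with p.232 («preserved under the composition»), dictionary] -/
theorem dT_transpose_mul (μ : Fin (d + 1)) (X : Matrix ↥(boxDom N) ↥(boxDom N) ℝ) :
    (dT N μ)ᵀ * X = -(shiftMat N (-unitVec μ) * (dT N μ * X)) := by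
  rw [dT_transpose]
  unfold dT
  rw [← Matrix.mul_assoc, Matrix.mul_sub, shiftMat_neg_mul_shiftMat, Matrix.mul_one, Matrix.sub_mul, Matrix.sub_mul,
    Matrix.one_mul]
  abel

/-- **`X∂_μ = −(X∂_μᵀ)σ_{e_μ}`**: the forward-difference-on-the-right of an operator is a unit translate of its
backward-difference-on-the-right. [cite: Balaban1984PropagatorsII, (2.67) p.234 with p.232 («preserved under the composition»), dictionary] -/
theorem mul_dT (μ : Fin (d + 1)) (X : Matrix ↥(boxDom N) ↥(boxDom N) ℝ) :
    X * dT N μ = -((X * (dT N μ)ᵀ) * shiftMat N (unitVec μ)) := by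
  rw [dT_transpose]
  unfold dT
  rw [Matrix.mul_assoc, Matrix.sub_mul, shiftMat_neg_mul_shiftMat, Matrix.one_mul, Matrix.mul_sub, Matrix.mul_sub,
    Matrix.mul_one]
  abel

/-- the sup norm of `s·e_μ`, `|s| ≤ 1`, is at most `1`. [cite: Balaban1983RegularityDecay, p.572, dictionary] -/
private theorem supNorm_single_le (μ : Fin (d + 1)) {s : ℤ} (hs : |s| ≤ 1) :
    supNorm (Pi.single μ s : Fin (d + 1) → ℤ) ≤ 1 := by
  refine Finset.sup'_le _ _ fun i _ => ?_
  by_cases hi : i = μ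
  · subst hi; rw [Pi.single_eq_same]; exact_mod_cast hs
  · rw [Pi.single_eq_of_ne hi, abs_zero]; norm_num

/-- the sup norm of `e_μ` is at most `1`. [cite: Balaban1983RegularityDecay, p.572, dictionary] -/
private theorem supNorm_unitVec_le (μ : Fin (d + 1)) : supNorm (unitVec μ : Fin (d + 1) → ℤ) ≤ 1 :=
  supNorm_single_le μ (by norm_num)

/-- the sup norm of `−e_μ` is at most `1`. [cite: Balaban1983RegularityDecay, p.572, dictionary] -/
private theorem supNorm_neg_unitVec_le (μ : Fin (d + 1)) : supNorm (-unitVec μ : Fin (d + 1) → ℤ) ≤ 1 := by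
  have e : (-unitVec μ : Fin (d + 1) → ℤ) = Pi.single μ (-1 : ℤ) := by unfold unitVec; rw [Pi.single_neg]
  rw [e]
  exact supNorm_single_le μ (by norm_num)

/-- a translation by `|v|_∞ ≤ 1` moves every site by at most one in the torus sup-distance: `|σ_v z − z|_T ≤ 1`.
[cite: Balaban1983RegularityDecay, p.572 («a torus T_η … with periodic conditions»), dictionary] -/
theorem torusSupNorm_tshift_sub_le {v : Fin (d + 1) → ℤ} (hv : supNorm v ≤ 1) (z : ↥(boxDom N)) :
    torusSupNorm N ((tshift N v z).1 - z.1) ≤ 1 := by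
  have hN1 : ∀ i, 1 ≤ N i := one_le_of_mem z.2
  obtain ⟨m, hm⟩ := tshift_val_eq_translate N v z
  have e : (tshift N v z).1 - z.1 = translate N v m := by
    rw [hm]
    funext i
    simp only [Pi.sub_apply, B4TorusKernel.MultiPeriod.translate_apply, Pi.add_apply]
    ring
  rw [e, torusSupNorm_translate]
  exact (torusSupNorm_le_supNorm hN1 _).trans hv

end ShiftAlgebra

/-! ## §2 Unit steps and blocks of a level-0 torus family; the touching-block count -/

section Blocks

variable {ℓ Mh k R : ℕ} {P : Fin (d + 1) → ℕ} (D : B6MultiLevelTorusOperatorL0.TDomains d ℓ Mh k P R)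

/-- a block-supported function is bounded by its bound everywhere. [cite: Balaban1984PropagatorsII, (2.51) p.232, bookkeeping] -/
theorem abs_le_of_blockSupp {f : ↥(boxDom (N0 ℓ Mh k P)) → ℝ} {y' : ↥(bset D.toDomains)} {B : ℝ}
    (hf : BlockSupp (g := geomT D) (blkOf D.toDomains) f y' B) (z : ↥(boxDom (N0 ℓ Mh k P))) : |f z| ≤ B := by
  by_cases hz : blkOf D.toDomains z = y'
  · exact hf.bound z hz
  · rw [hf.off z hz, abs_zero]; exact hf.nonneg

/-- **TWO SITES AT TORUS SUP-DISTANCE `≤ 1` LIE IN EQUAL OR ADJACENT BLOCKS** (admissible bond (2.46)).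
[cite: Balaban1984PropagatorsII, (2.46) p.231] -/
theorem blkOf_eq_or_adj_of_near {x x' : ↥(boxDom (N0 ℓ Mh k P))}
    (h : torusSupNorm (N0 ℓ Mh k P) (x.1 - x'.1) ≤ 1) :
    blkOf D.toDomains x = blkOf D.toDomains x' ∨ (bondT D).Adj (blkOf D.toDomains x) (blkOf D.toDomains x') := by
  by_cases he : blkOf D.toDomains x = blkOf D.toDomains x'
  · exact Or.inl he
  · exact Or.inr (bondT_adj.2 ⟨he, x, x', rfl, rfl, h⟩)

/-- the blocks of two sites at torus sup-distance `≤ 1` are at graph distance `≤ 1`. [cite: Balaban1984PropagatorsII, (2.46) p.231] -/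
theorem distT_le_one_of_near {x x' : ↥(boxDom (N0 ℓ Mh k P))}
    (h : torusSupNorm (N0 ℓ Mh k P) (x.1 - x'.1) ≤ 1) :
    (bondT D).dist (blkOf D.toDomains x) (blkOf D.toDomains x') ≤ 1 := by
  rcases blkOf_eq_or_adj_of_near D h with he | hadj
  · rw [he, SimpleGraph.dist_self]; exact zero_le_one
  · rw [SimpleGraph.dist_eq_one_iff_adj.2 hadj]

/-- **ADJACENT BLOCKS HAVE LEVELS DIFFERING BY AT MOST ONE** (the walk form (2.2) of the level gap, one-bond chains; needs
`RM ≥ 2`). [cite: Balaban1984PropagatorsII, (2.2) p.224, p.231 («the surface Σ_j separates»)] -/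
theorem levels_of_adj (hRM : 2 ≤ R * ((ℓ + 1) * Mh)) {s t : ↥(bset D.toDomains)} (h : (bondT D).Adj s t) :
    t.1.1 ≤ s.1.1 + 1 ∧ s.1.1 ≤ t.1.1 + 1 :=
  separates_of_levelGap (levelGapT D) (by omega) h

/-- equal-or-adjacent blocks have levels differing by at most one. [cite: Balaban1984PropagatorsII, (2.2) p.224, p.231] -/
theorem levels_of_eq_or_adj (hRM : 2 ≤ R * ((ℓ + 1) * Mh)) {s t : ↥(bset D.toDomains)}
    (h : s = t ∨ (bondT D).Adj s t) : t.1.1 ≤ s.1.1 + 1 ∧ s.1.1 ≤ t.1.1 + 1 := by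
  rcases h with rfl | hadj
  · exact ⟨Nat.le_succ _, Nat.le_succ _⟩
  · exact levels_of_adj D hRM hadj

/-- a block equal to or touching `y′` is at graph distance `≤ 1` from it. [cite: Balaban1984PropagatorsII, (2.46) p.231] -/
theorem distT_le_one_of_eq_or_touchT {t y' : ↥(bset D.toDomains)} (h : t = y' ∨ TouchT D t y') :
    (bondT D).dist t y' ≤ 1 := by
  by_cases he : t = y'
  · rw [he, SimpleGraph.dist_self]; exact zero_le_one
  · rcases h with h | h
    · exact absurd h he
    · rw [SimpleGraph.dist_eq_one_iff_adj.2 (bondT_adj.2 ⟨he, h⟩)]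

/-- powers of `L`, cast. [folklore] -/
private theorem castPow (n : ℕ) : (((ℓ + 1) ^ n : ℕ) : ℝ) = ((ℓ : ℝ) + 1) ^ n := by push_cast; ring

/-- **THE BLOCKS TOUCHING A GIVEN BLOCK NUMBER AT MOST `3(2L+1)^{d+1}`**: a block equal to or touching `y′ ∈ Λ_j` has level
`j−1`, `j` or `j+1` (level gap) and position within `L^{j+1}` of `y′`'s on the torus (bond lengths), and per level the
packing (2.58) counts at most `(2L+1)^{d+1}` such blocks. [cite: Balaban1984PropagatorsII, (2.58) p.233, (2.46) p.231, (2.2) p.224] -/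
theorem card_touching_le (hRM : 2 ≤ R * ((ℓ + 1) * Mh)) (y' : ↥(bset D.toDomains))
    (T : Finset ↥(bset D.toDomains)) (hT : ∀ t ∈ T, t = y' ∨ TouchT D t y') :
    ((#T : ℕ) : ℝ) ≤ 3 * (2 * ((ℓ : ℝ) + 1) + 1) ^ (d + 1) := by
  classical
  set j : ℕ := y'.1.1 with hj
  have hL1 : (1 : ℝ) ≤ (ℓ : ℝ) + 1 := by linarith [(Nat.cast_nonneg ℓ : (0 : ℝ) ≤ ℓ)]
  -- levels and positions of the members of `T`
  have hlev : ∀ t ∈ T, t.1.1 ≤ j + 1 ∧ j ≤ t.1.1 + 1 := by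
    intro t ht
    by_cases he : t = y'
    · rw [he]; exact ⟨Nat.le_succ _, Nat.le_succ _⟩
    · rcases hT t ht with h | h
      · exact absurd h he
      · have := levels_of_adj D hRM (bondT_adj.2 ⟨he, h⟩)
        exact ⟨this.2, this.1⟩
  have hpos : ∀ t ∈ T, dist (posT D t) (posT D y') ≤ (((ℓ + 1) ^ (t.1.1 + 1) : ℕ) : ℝ) := by
    intro t ht
    by_cases he : t = y'
    · rw [he, dist_self]; positivity
    · rcases hT t ht with h | h
      · exact absurd h he
      · refine (dist_posT_le_of_touchT h).trans ?_
        have hm : max t.1.1 y'.1.1 ≤ t.1.1 + 1 := max_le (Nat.le_succ _) (by rw [← hj]; exact (hlev t ht).2)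
        exact_mod_cast Nat.pow_le_pow_right (by omega) hm
  -- per level `i` with `j ≤ i + 1`: the packing
  have key : ∀ i : ℕ, ((#(T.filter (fun t => t.1.1 = i)) : ℕ) : ℝ) ≤ (2 * ((ℓ : ℝ) + 1) + 1) ^ (d + 1) := by
    intro i
    have hr : (0 : ℝ) ≤ (((ℓ + 1) ^ (i + 1) : ℕ) : ℝ) := by positivity
    have hS : ∀ s ∈ T.filter (fun t => t.1.1 = i), s.1.1 = i ∧ dist (posT D s) (posT D y') ≤ (((ℓ + 1) ^ (i + 1) : ℕ) : ℝ) := by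
      intro s hs
      rw [Finset.mem_filter] at hs
      refine ⟨hs.2, ?_⟩
      have := hpos s hs.1
      rw [hs.2] at this
      exact this
    refine (packT i (posT D y') _ _ hr hS).trans ?_
    have hLi : (0 : ℝ) < (((ℓ + 1) ^ i : ℕ) : ℝ) := by positivity
    have hratio : 2 * (((ℓ + 1) ^ (i + 1) : ℕ) : ℝ) / (((ℓ + 1) ^ i : ℕ) : ℝ) = 2 * ((ℓ : ℝ) + 1) := by
      rw [castPow, castPow, pow_succ]
      field_simp
    rw [hratio]
  -- the three levels
  have hsub : T ⊆ T.filter (fun t => t.1.1 = j - 1) ∪ T.filter (fun t => t.1.1 = j) ∪ T.filter (fun t => t.1.1 = j + 1) := by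
    intro t ht
    have h := hlev t ht
    simp only [Finset.mem_union, Finset.mem_filter, ht, true_and]
    omega
  have hcard : #T ≤ #(T.filter (fun t => t.1.1 = j - 1)) + #(T.filter (fun t => t.1.1 = j)) +
      #(T.filter (fun t => t.1.1 = j + 1)) :=
    (Finset.card_le_card hsub).trans ((Finset.card_union_le _ _).trans
      (Nat.add_le_add_right (Finset.card_union_le _ _) _))
  have hcast : ((#T : ℕ) : ℝ) ≤ ((#(T.filter (fun t => t.1.1 = j - 1)) : ℕ) : ℝ) +
      ((#(T.filter (fun t => t.1.1 = j)) : ℕ) : ℝ) + ((#(T.filter (fun t => t.1.1 = j + 1)) : ℕ) : ℝ) := by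
    exact_mod_cast hcard
  linarith [key (j - 1), key j, key (j + 1)]

end Blocks

/-! ## §3 Block majorants under a unit translation -/

section ShiftMajorants

variable {ℓ Mh k R : ℕ} {P : Fin (d + 1) → ℕ} (D : B6MultiLevelTorusOperatorL0.TDomains d ℓ Mh k P R)

/-- negation keeps a block majorant. [cite: Balaban1984PropagatorsII, (2.51) p.232, bookkeeping] -/
theorem hasMajorant_toLin'_neg {Y : Matrix ↥(boxDom (N0 ℓ Mh k P)) ↥(boxDom (N0 ℓ Mh k P)) ℝ}
    {K : ↥(bset D.toDomains) → ↥(bset D.toDomains) → ℝ}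
    (h : HasMajorant (g := geomT D) (blkOf D.toDomains) (Matrix.toLin' Y) K) :
    HasMajorant (g := geomT D) (blkOf D.toDomains) (Matrix.toLin' (-Y)) K := by
  intro y' f B hf x
  have h1 := h y' f B hf x
  rw [Matrix.toLin'_apply] at h1 ⊢
  rw [Matrix.neg_mulVec, Pi.neg_apply, abs_neg]
  exact h1

/-- **LEFT UNIT TRANSLATION** `σ_vY` (`|v|_∞ ≤ 1`): `(σ_vYλ)(x) = (Yλ)(σ_vx)` and the block of `σ_vx` is equal or adjacent to
the block of `x` (levels within one) — so any kernel `K′` dominating `K` across such pairs is a block majorant of `σ_vY`.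
[cite: Balaban1984PropagatorsII, (2.51)–(2.55) p.232 («preserved under the composition of operators possessing it»), (2.46) p.231] -/
theorem hasMajorant_shiftMat_mul (hRM : 2 ≤ R * ((ℓ + 1) * Mh)) {v : Fin (d + 1) → ℤ} (hv : supNorm v ≤ 1)
    {Y : Matrix ↥(boxDom (N0 ℓ Mh k P)) ↥(boxDom (N0 ℓ Mh k P)) ℝ}
    {K K' : ↥(bset D.toDomains) → ↥(bset D.toDomains) → ℝ}
    (hY : HasMajorant (g := geomT D) (blkOf D.toDomains) (Matrix.toLin' Y) K)
    (hK : ∀ y z y' : ↥(bset D.toDomains), (bondT D).dist y z ≤ 1 → z.1.1 ≤ y.1.1 + 1 → y.1.1 ≤ z.1.1 + 1 →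
      K z y' ≤ K' y y') :
    HasMajorant (g := geomT D) (blkOf D.toDomains) (Matrix.toLin' (shiftMat (N0 ℓ Mh k P) v * Y)) K' := by
  intro y' f B hf x
  rw [Matrix.toLin'_apply, ← Matrix.mulVec_mulVec, shiftMat_mulVec]
  have h1 := hY y' f B hf (tshift (N0 ℓ Mh k P) v x)
  rw [Matrix.toLin'_apply] at h1
  -- the blocks of `x` and `σ_v x`
  have hnear : torusSupNorm (N0 ℓ Mh k P) (x.1 - (tshift (N0 ℓ Mh k P) v x).1) ≤ 1 := by
    rw [show x.1 - (tshift (N0 ℓ Mh k P) v x).1 = -((tshift (N0 ℓ Mh k P) v x).1 - x.1) by abel,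
      torusSupNorm_neg (one_le_of_mem x.2)]
    exact torusSupNorm_tshift_sub_le _ hv x
  have hd := distT_le_one_of_near D hnear
  have hl := levels_of_eq_or_adj D hRM (blkOf_eq_or_adj_of_near D hnear)
  exact h1.trans (mul_le_mul_of_nonneg_right (hK _ _ _ hd hl.1 hl.2) hf.nonneg)

/-- **RIGHT UNIT TRANSLATION** `Yσ_v` (`|v|_∞ ≤ 1`): `σ_vλ` is supported in the blocks touching the block of `supp λ` — at most
`3(2L+1)^{d+1}` of them (`card_touching_le`) — and the block decomposition (2.52) of `σ_vλ` gives the majorant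
`3(2L+1)^{d+1}·K′` for any `K′ ≥ 0` dominating `K ≥ 0` across touching columns.
[cite: Balaban1984PropagatorsII, (2.52)–(2.55) p.232, (2.58) p.233, (2.46) p.231] -/
theorem hasMajorant_mul_shiftMat (hRM : 2 ≤ R * ((ℓ + 1) * Mh)) {v : Fin (d + 1) → ℤ} (hv : supNorm v ≤ 1)
    {Y : Matrix ↥(boxDom (N0 ℓ Mh k P)) ↥(boxDom (N0 ℓ Mh k P)) ℝ}
    {K K' : ↥(bset D.toDomains) → ↥(bset D.toDomains) → ℝ}
    (hY : HasMajorant (g := geomT D) (blkOf D.toDomains) (Matrix.toLin' Y) K)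
    (hK : ∀ y t y' : ↥(bset D.toDomains), (bondT D).dist t y' ≤ 1 → K y t ≤ K' y y')
    (hK'0 : ∀ y y', 0 ≤ K' y y') :
    HasMajorant (g := geomT D) (blkOf D.toDomains) (Matrix.toLin' (Y * shiftMat (N0 ℓ Mh k P) v))
      (fun y y' => 3 * (2 * ((ℓ : ℝ) + 1) + 1) ^ (d + 1) * K' y y') := by
  classical
  intro y' f B hf x
  have hB0 : 0 ≤ B := hf.nonneg
  rw [Matrix.toLin'_apply, ← Matrix.mulVec_mulVec]
  set g : ↥(boxDom (N0 ℓ Mh k P)) → ℝ := shiftMat (N0 ℓ Mh k P) v *ᵥ f with hg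
  have hgz : ∀ z, g z = f (tshift (N0 ℓ Mh k P) v z) := fun z => by rw [hg, shiftMat_mulVec]
  -- the touching blocks
  set T : Finset ↥(bset D.toDomains) := Finset.univ.filter (fun t => t = y' ∨ TouchT D t y') with hT
  have hTmem : ∀ t ∈ T, t = y' ∨ TouchT D t y' := fun t ht => (Finset.mem_filter.1 ht).2
  -- the pieces of `g`
  have hpiece : ∀ t, BlockSupp (g := geomT D) (blkOf D.toDomains) (blockPiece (blkOf D.toDomains) t g) t B := fun t =>
    blockSupp_blockPiece _ g t B hB0 (fun z _ => by rw [hgz]; exact abs_le_of_blockSupp D hf _)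
  have hzero : ∀ t, t ∉ T → blockPiece (g := geomT D) (blkOf D.toDomains) t g = 0 := by
    intro t ht
    funext z
    simp only [blockPiece, Pi.zero_apply]
    split_ifs with hz
    · rw [hgz]
      by_contra hne
      have hblk : blkOf D.toDomains (tshift (N0 ℓ Mh k P) v z) = y' := by
        by_contra h'
        exact hne (hf.off _ h')
      apply ht
      rw [hT, Finset.mem_filter]
      refine ⟨Finset.mem_univ _, ?_⟩
      by_cases hty : t = y'
      · exact Or.inl hty
      · refine Or.inr ⟨z, tshift (N0 ℓ Mh k P) v z, hz, hblk, ?_⟩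
        rw [show z.1 - (tshift (N0 ℓ Mh k P) v z).1 = -((tshift (N0 ℓ Mh k P) v z).1 - z.1) by abel,
          torusSupNorm_neg (one_le_of_mem z.2)]
        exact torusSupNorm_tshift_sub_le _ hv z
    · rfl
  -- the block decomposition (2.52) of the translated source
  have hdec : (Y *ᵥ g) x = ∑ t ∈ T, (Y *ᵥ blockPiece (g := geomT D) (blkOf D.toDomains) t g) x := by
    have hsum : Y *ᵥ g = ∑ t : ↥(bset D.toDomains), Y *ᵥ blockPiece (g := geomT D) (blkOf D.toDomains) t g := by
      conv_lhs => rw [← sum_blockPiece (g := geomT D) (blkOf D.toDomains) g]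
      rw [Matrix.mulVec_sum]
      rfl
    rw [hsum, Finset.sum_apply]
    refine (Finset.sum_subset (Finset.subset_univ T) ?_).symm
    intro t _ ht
    rw [hzero t ht, Matrix.mulVec_zero, Pi.zero_apply]
  rw [hdec]
  have hTcard := card_touching_le D hRM y' T hTmem
  calc |∑ t ∈ T, (Y *ᵥ blockPiece (g := geomT D) (blkOf D.toDomains) t g) x|
      ≤ ∑ t ∈ T, |(Y *ᵥ blockPiece (g := geomT D) (blkOf D.toDomains) t g) x| := Finset.abs_sum_le_sum_abs _ _
    _ ≤ ∑ t ∈ T, K (blkOf D.toDomains x) t * B := Finset.sum_le_sum fun t _ => by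
        have := hY t _ B (hpiece t) x
        rwa [Matrix.toLin'_apply] at this
    _ ≤ ∑ _t ∈ T, K' (blkOf D.toDomains x) y' * B := Finset.sum_le_sum fun t ht =>
        mul_le_mul_of_nonneg_right (hK _ t y' (distT_le_one_of_eq_or_touchT D (hTmem t ht))) hB0
    _ = ((#T : ℕ) : ℝ) * (K' (blkOf D.toDomains x) y' * B) := by rw [Finset.sum_const, nsmul_eq_mul]
    _ ≤ 3 * (2 * ((ℓ : ℝ) + 1) + 1) ^ (d + 1) * (K' (blkOf D.toDomains x) y' * B) :=
        mul_le_mul_of_nonneg_right hTcard (mul_nonneg (hK'0 _ _) hB0)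
    _ = 3 * (2 * ((ℓ : ℝ) + 1) + 1) ^ (d + 1) * K' (blkOf D.toDomains x) y' * B := by ring

/-- graph triangle inequality on the torus blocks, cast to `ℝ`. [cite: Balaban1984PropagatorsII, (2.54) p.232] -/
private theorem distT_triangle (hMh : 1 ≤ Mh) (hP : ∀ μ, 1 ≤ P μ) (a b c : ↥(bset D.toDomains)) :
    (((bondT D).dist a c : ℕ) : ℝ) ≤ (((bondT D).dist a b : ℕ) : ℝ) + (((bondT D).dist b c : ℕ) : ℝ) := by
  exact_mod_cast (connectedT (D := D) hMh hP).dist_triangle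

/-- **LEFT UNIT TRANSLATION OF A (2.67)₂-SHAPED MAJORANT**: `C·L^{j(y)}e^{−δd(y,y′)}` for `Y` gives `(C·L·e^{δ})·L^{j(y)}e^{−δd(y,y′)}`
for `σ_vY` (`|v|_∞ ≤ 1`; one level and one bond are lost to the translation). [cite: Balaban1984PropagatorsII, (2.67) p.234, (2.51)–(2.55) p.232] -/
theorem hasMajorant_shiftMat_mul_levelExp (hMh : 1 ≤ Mh) (hP : ∀ μ, 1 ≤ P μ) (hRM : 2 ≤ R * ((ℓ + 1) * Mh))
    {v : Fin (d + 1) → ℤ} (hv : supNorm v ≤ 1)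
    {Y : Matrix ↥(boxDom (N0 ℓ Mh k P)) ↥(boxDom (N0 ℓ Mh k P)) ℝ} {C δ : ℝ} (hC : 0 ≤ C) (hδ : 0 ≤ δ)
    (hY : HasMajorant (g := geomT D) (blkOf D.toDomains) (Matrix.toLin' Y)
      (fun y y' => C * ((ℓ : ℝ) + 1) ^ y.1.1 * Real.exp (-(δ * (geomT D).dist y y')))) :
    HasMajorant (g := geomT D) (blkOf D.toDomains) (Matrix.toLin' (shiftMat (N0 ℓ Mh k P) v * Y))
      (fun y y' => C * ((ℓ : ℝ) + 1) * Real.exp δ * ((ℓ : ℝ) + 1) ^ y.1.1 * Real.exp (-(δ * (geomT D).dist y y'))) := by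
  refine hasMajorant_shiftMat_mul D hRM hv hY fun y z y' hd hzy _ => ?_
  have hL1 : (1 : ℝ) ≤ (ℓ : ℝ) + 1 := by linarith [(Nat.cast_nonneg ℓ : (0 : ℝ) ≤ ℓ)]
  -- one level
  have hpow : ((ℓ : ℝ) + 1) ^ z.1.1 ≤ ((ℓ : ℝ) + 1) * ((ℓ : ℝ) + 1) ^ y.1.1 := by
    calc ((ℓ : ℝ) + 1) ^ z.1.1 ≤ ((ℓ : ℝ) + 1) ^ (y.1.1 + 1) := pow_le_pow_right₀ hL1 hzy
      _ = ((ℓ : ℝ) + 1) * ((ℓ : ℝ) + 1) ^ y.1.1 := by rw [pow_succ]; ring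
  -- one bond
  have hdyz : (((bondT D).dist y z : ℕ) : ℝ) ≤ 1 := by exact_mod_cast hd
  have htri := distT_triangle D hMh hP y z y'
  have hexp : Real.exp (-(δ * (geomT D).dist z y')) ≤ Real.exp δ * Real.exp (-(δ * (geomT D).dist y y')) := by
    rw [← Real.exp_add]
    refine Real.exp_le_exp.2 ?_
    show -(δ * (((bondT D).dist z y' : ℕ) : ℝ)) ≤ δ + -(δ * (((bondT D).dist y y' : ℕ) : ℝ))
    nlinarith
  have h0 : 0 ≤ Real.exp (-(δ * (geomT D).dist z y')) := (Real.exp_pos _).le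
  calc C * ((ℓ : ℝ) + 1) ^ z.1.1 * Real.exp (-(δ * (geomT D).dist z y'))
      ≤ C * (((ℓ : ℝ) + 1) * ((ℓ : ℝ) + 1) ^ y.1.1) * (Real.exp δ * Real.exp (-(δ * (geomT D).dist y y'))) :=
        mul_le_mul (mul_le_mul_of_nonneg_left hpow hC) hexp h0 (by positivity)
    _ = C * ((ℓ : ℝ) + 1) * Real.exp δ * ((ℓ : ℝ) + 1) ^ y.1.1 * Real.exp (-(δ * (geomT D).dist y y')) := by ring

/-- **RIGHT UNIT TRANSLATION OF A ROW-FACTOR MAJORANT**: `F(y)e^{−δd(y,y′)}` (`F ≥ 0`) for `Y` gives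
`3(2L+1)^{d+1}e^{δ}·F(y)e^{−δd(y,y′)}` for `Yσ_v` (`|v|_∞ ≤ 1`; one bond is lost, the touching pieces are counted).
[cite: Balaban1984PropagatorsII, (2.67) p.234, (2.52)–(2.55) p.232, (2.58) p.233] -/
theorem hasMajorant_mul_shiftMat_rowExp (hMh : 1 ≤ Mh) (hP : ∀ μ, 1 ≤ P μ) (hRM : 2 ≤ R * ((ℓ + 1) * Mh))
    {v : Fin (d + 1) → ℤ} (hv : supNorm v ≤ 1)
    {Y : Matrix ↥(boxDom (N0 ℓ Mh k P)) ↥(boxDom (N0 ℓ Mh k P)) ℝ} {F : ↥(bset D.toDomains) → ℝ} {δ : ℝ}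
    (hF : ∀ y, 0 ≤ F y) (hδ : 0 ≤ δ)
    (hY : HasMajorant (g := geomT D) (blkOf D.toDomains) (Matrix.toLin' Y)
      (fun y y' => F y * Real.exp (-(δ * (geomT D).dist y y')))) :
    HasMajorant (g := geomT D) (blkOf D.toDomains) (Matrix.toLin' (Y * shiftMat (N0 ℓ Mh k P) v))
      (fun y y' => 3 * (2 * ((ℓ : ℝ) + 1) + 1) ^ (d + 1) *
        (Real.exp δ * F y * Real.exp (-(δ * (geomT D).dist y y')))) := by
  refine hasMajorant_mul_shiftMat D hRM hv hY (fun y t y' hd => ?_) (fun y y' => by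
    have := hF y; positivity)
  have hdty : (((bondT D).dist t y' : ℕ) : ℝ) ≤ 1 := by exact_mod_cast hd
  have htri := distT_triangle D hMh hP y t y'
  have hexp : Real.exp (-(δ * (geomT D).dist y t)) ≤ Real.exp δ * Real.exp (-(δ * (geomT D).dist y y')) := by
    rw [← Real.exp_add]
    refine Real.exp_le_exp.2 ?_
    show -(δ * (((bondT D).dist y t : ℕ) : ℝ)) ≤ δ + -(δ * (((bondT D).dist y y' : ℕ) : ℝ))
    nlinarith
  calc F y * Real.exp (-(δ * (geomT D).dist y t)) ≤ F y * (Real.exp δ * Real.exp (-(δ * (geomT D).dist y y'))) :=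
        mul_le_mul_of_nonneg_left hexp (hF y)
    _ = Real.exp δ * F y * Real.exp (-(δ * (geomT D).dist y y')) := by ring

end ShiftMajorants

/-! ## §4 The two transports: `∂_μX ↦ ∂_μᵀX` and `X∂_μᵀ ↦ X∂_μ` -/

section Transports

variable {ℓ Mh k R : ℕ} {P : Fin (d + 1) → ℕ} (D : B6MultiLevelTorusOperatorL0.TDomains d ℓ Mh k P R)

/-- **FROM `∂_μX` TO `∂_μᵀX = ∇*_μX`** (backward difference on the left): a (2.67)₂-shaped majorant `C·L^{j(y)}e^{−δd}` of
`∂_μX` gives the majorant `(C·L·e^{δ})·L^{j(y)}e^{−δd}` of `∂_μᵀX` — `∂_μᵀX = −σ_{−e_μ}(∂_μX)` and §3.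
[cite: Balaban1984PropagatorsII, Prop. 2.2 (2.67)₂ p.234 with (2.51)–(2.55) p.232; Balaban1985BackgroundPropagators, Thm 3.1 (3.42) p.397] -/
theorem hasMajorant_dT_transpose_mul (hMh : 1 ≤ Mh) (hP : ∀ μ, 1 ≤ P μ) (hRM : 2 ≤ R * ((ℓ + 1) * Mh))
    (μ : Fin (d + 1)) {X : Matrix ↥(boxDom (N0 ℓ Mh k P)) ↥(boxDom (N0 ℓ Mh k P)) ℝ} {C δ : ℝ} (hC : 0 ≤ C) (hδ : 0 ≤ δ)
    (hX : HasMajorant (g := geomT D) (blkOf D.toDomains) (Matrix.toLin' (dT (N0 ℓ Mh k P) μ * X))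
      (fun y y' => C * ((ℓ : ℝ) + 1) ^ y.1.1 * Real.exp (-(δ * (geomT D).dist y y')))) :
    HasMajorant (g := geomT D) (blkOf D.toDomains) (Matrix.toLin' ((dT (N0 ℓ Mh k P) μ)ᵀ * X))
      (fun y y' => C * ((ℓ : ℝ) + 1) * Real.exp δ * ((ℓ : ℝ) + 1) ^ y.1.1 * Real.exp (-(δ * (geomT D).dist y y'))) := by
  rw [dT_transpose_mul]
  exact hasMajorant_toLin'_neg D
    (hasMajorant_shiftMat_mul_levelExp D hMh hP hRM (supNorm_neg_unitVec_le μ) hC hδ hX)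

/-- **FROM `X∂_μᵀ = X∇*_μ` (up to sign) TO `X∂_μ`** (forward difference on the right): a (2.67)₃-shaped majorant
`C·L^{j(y)}e^{−δd}` of `X∂_μᵀ` gives the majorant `(3(2L+1)^{d+1}e^{δ}C)·L^{j(y)}e^{−δd}` of `X∂_μ` — `X∂_μ = −(X∂_μᵀ)σ_{e_μ}`
and §3. [cite: Balaban1984PropagatorsII, Prop. 2.2 (2.67)₃ p.234 with (2.52)–(2.55) p.232, (2.58) p.233; Balaban1985BackgroundPropagators, Thm 3.1 (3.42) p.397] -/
theorem hasMajorant_mul_dT (hMh : 1 ≤ Mh) (hP : ∀ μ, 1 ≤ P μ) (hRM : 2 ≤ R * ((ℓ + 1) * Mh))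
    (μ : Fin (d + 1)) {X : Matrix ↥(boxDom (N0 ℓ Mh k P)) ↥(boxDom (N0 ℓ Mh k P)) ℝ} {C δ : ℝ} (hC : 0 ≤ C) (hδ : 0 ≤ δ)
    (hX : HasMajorant (g := geomT D) (blkOf D.toDomains) (Matrix.toLin' (X * (dT (N0 ℓ Mh k P) μ)ᵀ))
      (fun y y' => C * ((ℓ : ℝ) + 1) ^ y.1.1 * Real.exp (-(δ * (geomT D).dist y y')))) :
    HasMajorant (g := geomT D) (blkOf D.toDomains) (Matrix.toLin' (X * dT (N0 ℓ Mh k P) μ))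
      (fun y y' => 3 * (2 * ((ℓ : ℝ) + 1) + 1) ^ (d + 1) * Real.exp δ * C * ((ℓ : ℝ) + 1) ^ y.1.1 *
        Real.exp (-(δ * (geomT D).dist y y'))) := by
  rw [mul_dT]
  have hF : ∀ y : ↥(bset D.toDomains), 0 ≤ C * ((ℓ : ℝ) + 1) ^ y.1.1 := fun y => by positivity
  have h := hasMajorant_toLin'_neg D
    (hasMajorant_mul_shiftMat_rowExp D hMh hP hRM (supNorm_unitVec_le μ) (F := fun y => C * ((ℓ : ℝ) + 1) ^ y.1.1)
      hF hδ hX)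
  refine hasMajorant_mono _ h fun y y' => le_of_eq ?_
  ring

end Transports

/-! ## §5 At the cube letters of file 2: `∇*_μG′_□(1)` and `G′_□(1)∇_μ` -/

section Cube

variable {ℓ : ℕ}

/-- **(3.42)₂, TRANSPOSED ORIENTATION, AT `U = 1` FOR `G′_□`** (weights `wCube`): for every axis `μ` the operator
`∂_μᵀG′_□(1) = −∇*_μG′_□(1)` (backward difference on the LEFT) has the block majorant `C·L^{j(y)}·e^{−(δ₀/2)d(y,y′)}` over the
cube family's geometry — file 2's `thm31_cubeW_flat_second` (print's `∇_μG′_□`) composed with the unit translation `σ_{−e_μ}`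
(§4); constants depend on `d, L` only, the rate `δ₀/2` is that of file 2.
[cite: Balaban1985BackgroundPropagators, Thm 3.1 (3.42) p.397 (second entry) with Cor. 3.5 p.407 and p.409 l.1–5; Balaban1984PropagatorsII, Prop. 2.2 (2.67)₂ p.234, p.232 («preserved under the composition»)] -/
theorem thm31_cubeW_flat_second_transpose (d ℓ : ℕ) (hℓ : 1 ≤ ℓ) :
    ∃ δ₀ C M₀ : ℝ, ∃ N₀ : ℕ, 0 < δ₀ ∧ 0 < C ∧ 0 < M₀ ∧ 0 < N₀ ∧
      ∀ {Mh k R : ℕ} {P : Fin (d + 1) → ℕ} (D : B6MultiLevelTorusOperator.TDomains d ℓ Mh k P R)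
        (q : ↥(cubes D.toDomains)) (hL : Odd (ℓ + 1)) (hM : Odd Mh) (hMh : 1 ≤ Mh) (hP : ∀ μ, 1 ≤ P μ),
        3 ≤ Mh → M₀ ≤ ((ℓ : ℝ) + 1) * Mh → 2 * (ℓ + 1) ≤ R → N₀ + 1 ≤ R * ((ℓ + 1) * Mh) → (∀ μ, 4 ≤ P μ) →
        ∀ μ : Fin (d + 1),
        HasMajorant (g := geomT (cubeFam D q hL hM hMh hP)) (blkOf (cubeFam D q hL hM hMh hP).toDomains)
          (Matrix.toLin' ((dT (N0 ℓ Mh k P) μ)ᵀ * GpCubeW D q hL hM hMh hP))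
          (fun y y' => C * ((ℓ : ℝ) + 1) ^ y.1.1 *
            Real.exp (-(δ₀ / 2 * (geomT (cubeFam D q hL hM hMh hP)).dist y y'))) := by
  obtain ⟨δ₀, C, M₀, N₀, hδ₀, hC, hM₀, hN₀, h⟩ := thm31_cubeW_flat_second d ℓ hℓ
  refine ⟨δ₀, C * ((ℓ : ℝ) + 1) * Real.exp (δ₀ / 2), M₀, N₀, hδ₀, by positivity, hM₀, hN₀, ?_⟩
  intro Mh k R P D q hL hM hMh hP h3 hM0 hR hN0 hP4 μ
  have hRM : 2 ≤ R * ((ℓ + 1) * Mh) := by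
    have h1 : 1 ≤ (ℓ + 1) * Mh := Nat.one_le_iff_ne_zero.2 (Nat.mul_ne_zero (by omega) (by omega))
    calc 2 ≤ 2 * (ℓ + 1) := by omega
      _ ≤ R := hR
      _ = R * 1 := (Nat.mul_one R).symm
      _ ≤ R * ((ℓ + 1) * Mh) := Nat.mul_le_mul_left R h1
  exact hasMajorant_dT_transpose_mul (cubeFam D q hL hM hMh hP) hMh hP hRM μ hC.le (by positivity)
    (h D q hL hM hMh hP h3 hM0 hR hN0 hP4 μ)

/-- **(3.42)₃, TRANSPOSED ORIENTATION, AT `U = 1` FOR `G′_□`** (weights `wCube`): for every axis `μ` the operator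
`G′_□(1)∂_μ` (forward difference on the RIGHT) has the block majorant `C·L^{j(y)}·e^{−(δ₀/2)d(y,y′)}` over the cube family's
geometry — file 2's `thm31_cubeW_flat_third` (print's `G′_□∇*_μ`) composed with the unit translation `σ_{e_μ}` (§4; the
touching-block count enters `C`); constants depend on `d, L` only, the rate `δ₀/2` is that of file 2.
[cite: Balaban1985BackgroundPropagators, Thm 3.1 (3.42) p.397 (third entry) with Cor. 3.5 p.407 and p.409 l.1–5; Balaban1984PropagatorsII, Prop. 2.2 (2.67)₃ p.234, p.232 («preserved under the composition»), (2.58) p.233] -/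
theorem thm31_cubeW_flat_third_transpose (d ℓ : ℕ) (hℓ : 1 ≤ ℓ) :
    ∃ δ₀ C M₀ : ℝ, ∃ N₀ : ℕ, 0 < δ₀ ∧ 0 < C ∧ 0 < M₀ ∧ 0 < N₀ ∧
      ∀ {Mh k R : ℕ} {P : Fin (d + 1) → ℕ} (D : B6MultiLevelTorusOperator.TDomains d ℓ Mh k P R)
        (q : ↥(cubes D.toDomains)) (hL : Odd (ℓ + 1)) (hM : Odd Mh) (hMh : 1 ≤ Mh) (hP : ∀ μ, 1 ≤ P μ),
        3 ≤ Mh → M₀ ≤ ((ℓ : ℝ) + 1) * Mh → 2 * (ℓ + 1) ≤ R → N₀ + 1 ≤ R * ((ℓ + 1) * Mh) → (∀ μ, 4 ≤ P μ) →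
        ∀ μ : Fin (d + 1),
        HasMajorant (g := geomT (cubeFam D q hL hM hMh hP)) (blkOf (cubeFam D q hL hM hMh hP).toDomains)
          (Matrix.toLin' (GpCubeW D q hL hM hMh hP * dT (N0 ℓ Mh k P) μ))
          (fun y y' => C * ((ℓ : ℝ) + 1) ^ y.1.1 *
            Real.exp (-(δ₀ / 2 * (geomT (cubeFam D q hL hM hMh hP)).dist y y'))) := by
  obtain ⟨δ₀, C, M₀, N₀, hδ₀, hC, hM₀, hN₀, h⟩ := thm31_cubeW_flat_third d ℓ hℓ
  refine ⟨δ₀, 3 * (2 * ((ℓ : ℝ) + 1) + 1) ^ (d + 1) * Real.exp (δ₀ / 2) * C, M₀, N₀, hδ₀, by positivity, hM₀, hN₀, ?_⟩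
  intro Mh k R P D q hL hM hMh hP h3 hM0 hR hN0 hP4 μ
  have hRM : 2 ≤ R * ((ℓ + 1) * Mh) := by
    have h1 : 1 ≤ (ℓ + 1) * Mh := Nat.one_le_iff_ne_zero.2 (Nat.mul_ne_zero (by omega) (by omega))
    calc 2 ≤ 2 * (ℓ + 1) := by omega
      _ ≤ R := hR
      _ = R * 1 := (Nat.mul_one R).symm
      _ ≤ R * ((ℓ + 1) * Mh) := Nat.mul_le_mul_left R h1
  exact hasMajorant_mul_dT (cubeFam D q hL hM hMh hP) hMh hP hRM μ hC.le (by positivity)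
    (h D q hL hM hMh hP h3 hM0 hR hN0 hP4 μ)

end Cube

end

end Literature.MathematicalPhysics.QuantumFieldTheory.Balaban1983to89.B9Thm31CubeLocalFlatTransposed
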